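import Mathlib

/-!
# Tier4/Common/UnitaryHyperbolic — the unitary group `U(J)` of a hermitian form of signature `(1, 1)` on `ℂ²`, and the
Cayley transform `SL(2, ℝ) → SU(1, 1)`

Blind re-derivation cell `pub-hodge-repro`, Tier 4 (README §9–§10), seat t4-typer-2 (gen 5).  Target tree path
`lean/Summits/Ventures/HodgeRepro/Tier4/Common/UnitaryHyperbolic.lean`; imports Mathlib only.  STAGE C1 of
C-COMMON-SL2BALL (offer S15543, taken S15558), module 1/3:
* `Jmat α β = diagonal ![α, β]` (hermitian), `l1C M = ∑ i j, ‖M i j‖` (the `ℓ¹` entry norm on `M₂(ℂ)`, continuous);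
* **`UJ α β : Subgroup (GL (Fin 2) ℂ)`**, carrier `{m | m * J * mᴴ = J}` (`inv_mem` by `m⁻¹ = J mᴴ J⁻¹`); it is CLOSED in
  `GL(2, ℂ)` (`isClosed_UJ`), and `↥(UJ α β)` is locally compact, second countable and Hausdorff (the Units topology is a
  closed embedding into `M₂(ℂ) × M₂(ℂ)ᵐᵒᵖ`, `Units.isClosedEmbedding_embedProduct`) — the `H`-binders of stage B;
* the CAYLEY TRANSFORM `cay₀ h = C₀ * h * C₀⁻¹` with `C₀ = !![1, -I; 1, I]` (lit-3 row 52, Borel §4.1): multiplicative,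
  `cay₀ h = !![a, b; conj b, conj a]` with `a = ((p + s) + (q − r) i)/2`, `b = ((p − s) − (q + r) i)/2`,
  `|a|² − |b|² = det h = 1`, hence **`cay₀_mem_su11 : cay₀ h * J₀ * (cay₀ h)ᴴ = J₀`** (`J₀ = diag (1, -1)`).
Module 2/3 (`UnitaryHyperbolicCayley`): the homomorphism `Circle × SL(2, ℝ) →* ↥(UJ α β)` for `α > 0 > β`, continuous and
surjective; module 3/3 (`UnitaryHyperbolicGrowth`): properness, the norm comparison and the ball growth of `U(J)`.

Nothing here says anything about the status of the Hodge conjecture for CM abelian varieties, which is NOT proved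
(HC_CM is NOT proved by anyone in this repository).
-/

set_option autoImplicit false

noncomputable section

open Matrix Topology
open scoped MatrixGroups ComplexConjugate

namespace Summit.Ventures.HodgeRepro.Tier4.Common

namespace SL2Ball

/-! ## 1. The form and its unitary group -/

/-- The matrix of the hermitian form `diag (α, β)` on `ℂ²`. -/
def Jmat (α β : ℝ) : Matrix (Fin 2) (Fin 2) ℂ := diagonal ![(α : ℂ), (β : ℂ)]

/-- `Jmat` is hermitian (a real diagonal matrix). -/
theorem Jmat_conjTranspose (α β : ℝ) : (Jmat α β)ᴴ = Jmat α β := by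
  ext i j
  fin_cases i <;> fin_cases j <;> simp [Jmat, Matrix.diagonal]

/-- The `ℓ¹` entry norm of a complex `2 × 2` matrix. -/
def l1C (M : Matrix (Fin 2) (Fin 2) ℂ) : ℝ := ∑ i : Fin 2, ∑ j : Fin 2, ‖M i j‖

/-- `l1C M ≥ 0`. -/
theorem l1C_nonneg (M : Matrix (Fin 2) (Fin 2) ℂ) : 0 ≤ l1C M :=
  Finset.sum_nonneg fun _ _ => Finset.sum_nonneg fun _ _ => norm_nonneg _

/-- `l1C` is continuous. -/
theorem continuous_l1C : Continuous l1C := by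
  unfold l1C
  exact continuous_finsetSum _ fun i _ => continuous_finsetSum _ fun j _ => (continuous_id.matrix_elem i j).norm

/-- The unitary group of the form `Jmat α β`, as a subgroup of `GL (Fin 2) ℂ`. -/
def UJ (α β : ℝ) : Subgroup (GL (Fin 2) ℂ) where
  carrier := {m | (m : Matrix (Fin 2) (Fin 2) ℂ) * Jmat α β * (m : Matrix (Fin 2) (Fin 2) ℂ)ᴴ = Jmat α β}
  one_mem' := by simp
  mul_mem' := by
    intro m n hm hn
    simp only [Set.mem_setOf_eq, Units.val_mul, conjTranspose_mul] at hm hn ⊢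
    calc (m : Matrix (Fin 2) (Fin 2) ℂ) * n * Jmat α β * ((n : Matrix (Fin 2) (Fin 2) ℂ)ᴴ * (m : Matrix (Fin 2) (Fin 2) ℂ)ᴴ)
        = (m : Matrix (Fin 2) (Fin 2) ℂ) * ((n : Matrix (Fin 2) (Fin 2) ℂ) * Jmat α β * (n : Matrix (Fin 2) (Fin 2) ℂ)ᴴ) *
            (m : Matrix (Fin 2) (Fin 2) ℂ)ᴴ := by
          simp only [Matrix.mul_assoc]
      _ = Jmat α β := by rw [hn, hm]
  inv_mem' := by
    intro m hm
    simp only [Set.mem_setOf_eq] at hm ⊢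
    calc (↑m⁻¹ : Matrix (Fin 2) (Fin 2) ℂ) * Jmat α β * (↑m⁻¹ : Matrix (Fin 2) (Fin 2) ℂ)ᴴ
        = (↑m⁻¹ : Matrix (Fin 2) (Fin 2) ℂ) * ((m : Matrix (Fin 2) (Fin 2) ℂ) * Jmat α β * (m : Matrix (Fin 2) (Fin 2) ℂ)ᴴ) *
            (↑m⁻¹ : Matrix (Fin 2) (Fin 2) ℂ)ᴴ := by rw [hm]
      _ = ((↑m⁻¹ : Matrix (Fin 2) (Fin 2) ℂ) * (m : Matrix (Fin 2) (Fin 2) ℂ)) * Jmat α β *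
            ((↑m⁻¹ : Matrix (Fin 2) (Fin 2) ℂ) * (m : Matrix (Fin 2) (Fin 2) ℂ))ᴴ := by
          rw [conjTranspose_mul]
          simp only [Matrix.mul_assoc]
      _ = Jmat α β := by
          rw [Units.inv_mul]
          simp

/-- Membership in `UJ`. -/
theorem mem_UJ {α β : ℝ} {m : GL (Fin 2) ℂ} :
    m ∈ UJ α β ↔ (m : Matrix (Fin 2) (Fin 2) ℂ) * Jmat α β * (m : Matrix (Fin 2) (Fin 2) ℂ)ᴴ = Jmat α β := Iff.rfl

/-! ## 2. Topology of `U(J)`: closed in `GL(2, ℂ)`, locally compact, second countable -/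

/-- `UJ α β` is a closed subset of `GL (Fin 2) ℂ`. -/
theorem isClosed_UJ (α β : ℝ) : IsClosed (UJ α β : Set (GL (Fin 2) ℂ)) := by
  have hc : Continuous fun m : GL (Fin 2) ℂ =>
      (m : Matrix (Fin 2) (Fin 2) ℂ) * Jmat α β * (m : Matrix (Fin 2) (Fin 2) ℂ)ᴴ := by
    have hv : Continuous fun m : GL (Fin 2) ℂ => (m : Matrix (Fin 2) (Fin 2) ℂ) := Units.continuous_val
    exact (hv.matrix_mul continuous_const).matrix_mul hv.matrix_conjTranspose
  exact isClosed_eq hc continuous_const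

/-- The embedding of `↥(UJ α β)` into `M₂(ℂ) × M₂(ℂ)ᵐᵒᵖ`, `g ↦ (g, g⁻¹)`, is a closed embedding. -/
theorem isClosedEmbedding_UJ_embed (α β : ℝ) :
    IsClosedEmbedding fun g : ↥(UJ α β) => Units.embedProduct (Matrix (Fin 2) (Fin 2) ℂ) (g : GL (Fin 2) ℂ) :=
  (Units.isClosedEmbedding_embedProduct (α := Matrix (Fin 2) (Fin 2) ℂ)).comp
    (isClosed_UJ α β).isClosedEmbedding_subtypeVal

/-- `↥(UJ α β)` is locally compact. -/
theorem locallyCompactSpace_UJ (α β : ℝ) : LocallyCompactSpace ↥(UJ α β) :=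
  haveI : LocallyCompactSpace (Matrix (Fin 2) (Fin 2) ℂ) :=
    inferInstanceAs (LocallyCompactSpace (Fin 2 → Fin 2 → ℂ))
  (isClosedEmbedding_UJ_embed α β).locallyCompactSpace

/-- `↥(UJ α β)` is second countable. -/
theorem secondCountableTopology_UJ (α β : ℝ) : SecondCountableTopology ↥(UJ α β) :=
  haveI : SecondCountableTopology (Matrix (Fin 2) (Fin 2) ℂ) :=
    inferInstanceAs (SecondCountableTopology (Fin 2 → Fin 2 → ℂ))
  haveI : SecondCountableTopology (Matrix (Fin 2) (Fin 2) ℂ)ᵐᵒᵖ :=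
    (MulOpposite.opHomeomorph (M := Matrix (Fin 2) (Fin 2) ℂ)).symm.isEmbedding.secondCountableTopology
  (isClosedEmbedding_UJ_embed α β).isEmbedding.secondCountableTopology

/-- `↥(UJ α β)` is Hausdorff. -/
theorem t2Space_UJ (α β : ℝ) : T2Space ↥(UJ α β) :=
  (isClosedEmbedding_UJ_embed α β).isEmbedding.t2Space

/-! ## 3. The Cayley transform `SL(2, ℝ) → SU(1, 1)` -/

/-- The standard indefinite form `J₀ = diag (1, -1)`. -/
def J₀ : Matrix (Fin 2) (Fin 2) ℂ := Jmat 1 (-1)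

/-- The Cayley matrix `C₀ = !![1, -I; 1, I]`. -/
def C₀ : Matrix (Fin 2) (Fin 2) ℂ := !![1, -Complex.I; 1, Complex.I]

/-- The inverse Cayley matrix `C₀⁻¹ = ½ !![1, 1; I, -I]`. -/
def C₀inv : Matrix (Fin 2) (Fin 2) ℂ := !![(1 / 2 : ℂ), 1 / 2; Complex.I / 2, -Complex.I / 2]

/-- `C₀⁻¹ * C₀ = 1`. -/
theorem C₀inv_mul_C₀ : C₀inv * C₀ = 1 := by
  ext i j
  fin_cases i <;> fin_cases j <;>
    simp [C₀, C₀inv, Matrix.mul_apply, Fin.sum_univ_two, Complex.ext_iff] <;> norm_num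

/-- `C₀ * C₀⁻¹ = 1`. -/
theorem C₀_mul_C₀inv : C₀ * C₀inv = 1 := by
  ext i j
  fin_cases i <;> fin_cases j <;>
    simp [C₀, C₀inv, Matrix.mul_apply, Fin.sum_univ_two, Complex.ext_iff] <;> norm_num

/-- A real matrix as a complex matrix. -/
def toC (M : Matrix (Fin 2) (Fin 2) ℝ) : Matrix (Fin 2) (Fin 2) ℂ := Complex.ofRealHom.mapMatrix M

/-- `toC` entrywise. -/
@[simp] theorem toC_apply (M : Matrix (Fin 2) (Fin 2) ℝ) (i j : Fin 2) : toC M i j = (M i j : ℂ) := rfl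

/-- `toC` is multiplicative. -/
theorem toC_mul (M N : Matrix (Fin 2) (Fin 2) ℝ) : toC (M * N) = toC M * toC N := map_mul _ _ _

/-- `toC 1 = 1`. -/
theorem toC_one : toC 1 = 1 := map_one _

/-- The Cayley transform of `h ∈ SL(2, ℝ)`: `C₀ * h * C₀⁻¹`. -/
def cay₀ (h : SL(2, ℝ)) : Matrix (Fin 2) (Fin 2) ℂ := C₀ * toC (h : Matrix (Fin 2) (Fin 2) ℝ) * C₀inv

/-- `cay₀` is multiplicative. -/
theorem cay₀_mul (h₁ h₂ : SL(2, ℝ)) : cay₀ (h₁ * h₂) = cay₀ h₁ * cay₀ h₂ := by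
  simp only [cay₀, Matrix.SpecialLinearGroup.coe_mul, toC_mul]
  calc C₀ * (toC h₁ * toC h₂) * C₀inv = C₀ * toC h₁ * (C₀inv * C₀) * toC h₂ * C₀inv := by
        rw [C₀inv_mul_C₀, Matrix.mul_one]
        simp only [Matrix.mul_assoc]
    _ = _ := by simp only [Matrix.mul_assoc]

/-- `cay₀ 1 = 1`. -/
theorem cay₀_one : cay₀ 1 = 1 := by
  simp only [cay₀, Matrix.SpecialLinearGroup.coe_one, toC_one, Matrix.mul_one, C₀_mul_C₀inv]

/-- The `(0,0)` entry `a = ((p + s) + (q - r) i) / 2` of the Cayley transform of `!![p, q; r, s]`. -/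
def cayA (h : SL(2, ℝ)) : ℂ := ⟨(h 0 0 + h 1 1) / 2, (h 0 1 - h 1 0) / 2⟩

/-- The `(0,1)` entry `b = ((p - s) - (q + r) i) / 2` of the Cayley transform of `!![p, q; r, s]`. -/
def cayB (h : SL(2, ℝ)) : ℂ := ⟨(h 0 0 - h 1 1) / 2, -((h 0 1 + h 1 0) / 2)⟩

/-- The Cayley transform has the `SU(1,1)` shape `!![a, b; conj b, conj a]`. -/
theorem cay₀_eq (h : SL(2, ℝ)) : cay₀ h = !![cayA h, cayB h; conj (cayB h), conj (cayA h)] := by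
  ext i j
  simp only [cay₀, Matrix.mul_apply, Fin.sum_univ_two]
  fin_cases i <;> fin_cases j <;>
    simp [C₀, C₀inv, cayA, cayB, Complex.ext_iff] <;> constructor <;> ring

/-- `|a|² - |b|² = det h = 1` for the Cayley transform. -/
theorem normSq_cayA_sub_normSq_cayB (h : SL(2, ℝ)) : Complex.normSq (cayA h) - Complex.normSq (cayB h) = 1 := by
  have hdet : h 0 0 * h 1 1 - h 0 1 * h 1 0 = 1 := by
    rw [← Matrix.det_fin_two]
    exact Matrix.SpecialLinearGroup.det_coe h
  simp only [cayA, cayB, Complex.normSq_apply]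
  linear_combination hdet

/-- A matrix of the shape `!![a, b; conj b, conj a]` with `|a|² - |b|² = 1` lies in `SU(1, 1)`. -/
theorem su11_of_shape (a b : ℂ) (hab : Complex.normSq a - Complex.normSq b = 1) :
    !![a, b; conj b, conj a] * J₀ * (!![a, b; conj b, conj a])ᴴ = J₀ := by
  simp only [Complex.normSq_apply] at hab
  ext i j
  simp only [Matrix.mul_apply, Fin.sum_univ_two, Matrix.conjTranspose_apply]
  fin_cases i <;> fin_cases j <;>
    simp [J₀, Jmat, Complex.ext_iff] <;> constructor <;> nlinarith [hab]

/-- The Cayley transform lands in `SU(1, 1)`: `cay₀ h * J₀ * (cay₀ h)ᴴ = J₀`. -/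
theorem cay₀_mem_su11 (h : SL(2, ℝ)) : cay₀ h * J₀ * (cay₀ h)ᴴ = J₀ := by
  rw [cay₀_eq]
  exact su11_of_shape _ _ (normSq_cayA_sub_normSq_cayB h)

end SL2Ball

end Summit.Ventures.HodgeRepro.Tier4.Common
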